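import Mathlib
import HarnessLib
import Summits.NavierStokesRegularity.NavierStokesRegularity.Theorems.UnthreadedRigidityDoorWindowPotentialEvolution
import Summits.NavierStokesRegularity.NavierStokesRegularity.Theorems.UnthreadedRigidityDoorWindowToroidalPotential

/-!
# Route UnthreadedRigidityDoor · crux `UnthreadedRigidity` (stmt-NavierStokesRegularity-27585) · LINE «jet rigidity»
# (planner ns-idea-6 g5, birth skeleton sha16 `5d320f85a8de9ffc`) — stub `stub_windowPotentialLaw` VERBATIM

Seat ns-qj-p1 g3 (director-ns KEY-NS #141 (1)(ii): the ASSEMBLY), `--supports stmt-NavierStokesRegularity-27585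
--as helper`. The registered stub `StubWindowPotentialLaw` (binders restated — a Theorems file cannot import the
planner's HOME skeleton): for an open time set `S`, a classical solution `u` of the vorticity formulation on `S`
(unit viscosity) that is UNTHREADED about `x₀` (`⟪curl u(t)(x), x − x₀⟫ = 0` on `S × ℝ³`), there is a toroidal
potential `T`, jointly `C^∞` on `S × (ℝ³ ∖ {x₀})`, with

  (i) `curl u(t)(x) = ∇T(t)(x) × (x − x₀)` for all `t ∈ S` and all `x`, and
  (ii) the exact evolution law `∇(∂ₜT + ⟪u, ∇T⟫ − ΔT) × (x − x₀) = ∇⟪u, x − x₀⟫ × ∇T` on `S × (ℝ³ ∖ {x₀})`  (E1).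

ASSEMBLY of two landed halves: (i) = `exists_windowToroidalPotential`
(`UnthreadedRigidityDoorWindowToroidalPotential`: the open-window form of ns-es-p1 g4's 1222 construction — radial
pull-back of the closed sphere form `‖y‖⁻²(y × ω)`, Poincaré primitive, chord integrals in two charts), and
(ii) = `potentialEvolution_of_isOpen` (`UnthreadedRigidityDoorWindowPotentialEvolution`: the vorticity equation
with `ω = ∇T × y`, Schwarz, Hessian symmetry, and the cofactor identity with `tr Du = div u = 0`).

HONEST FRAMING: a kinematic/calculus statement about HYPOTHETICAL unthreaded window solutions (local blow-up
profiles of the door); it is one stub of a line whose wall (`stub_shearedRigidity`) is OPEN; nothing here bears on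
`UnthreadedRigidity`, the door Target, or Navier–Stokes regularity; no summit statement is proved. [folklore]

References: G. Backus, Rev. Geophys. 24 (1986) §2; A. J. Majda, A. L. Bertozzi (CUP 2002) §1.1, Prop. 2.4.
-/

noncomputable section

-- the summit and its single sub-problem share the name (CONVENTIONS §1), as in every Theorems file
set_option linter.dupNamespace false

namespace Summit.NavierStokesRegularity.NavierStokesRegularity.Theorems.UnthreadedRigidity

open MeasureTheory Set Function Filter
open scoped RealInnerProductSpace InnerProductSpace ContDiff Laplacian
open Literature.Analysis.FluidPDE

/-- **Stub `stub_windowPotentialLaw` of the registered birth skeleton of crux `UnthreadedRigidity`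
(stmt-NavierStokesRegularity-27585; LINE «jet rigidity», planner ns-idea-6 g5, sha16 `5d320f85a8de9ffc`), signature
VERBATIM (`StubWindowPotentialLaw`).** An unthreaded classical solution of the vorticity formulation on an open
window has a toroidal potential (open-window form of ns-es-p1 g4's 1222 construction,
`PoloidalLiouville.exists_windowToroidalPotential`) obeying the exact evolution law (E1)
(`PoloidalLiouville.potentialEvolution_of_isOpen`). Nothing here bears on `UnthreadedRigidity` or Navier–Stokes
regularity. [cite: Backus1986, §2 (Mie representation); MajdaBertozziCUP2002, Prop. 2.4 eq. (2.110)] -/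
theorem windowPotentialLaw :
    ∀ (S : Set ℝ) (u : ℝ → EuclideanSpace ℝ (Fin 3) → EuclideanSpace ℝ (Fin 3)) (x₀ : EuclideanSpace ℝ (Fin 3)),
    IsOpen S → Literature.Analysis.FluidPDE.IsVorticitySolutionOn S 1 u →
    (∀ t ∈ S, ∀ x, ⟪Literature.Analysis.FluidPDE.curl (u t) x, x - x₀⟫_ℝ = 0) →
    ∃ T : ℝ → EuclideanSpace ℝ (Fin 3) → ℝ,
      ContDiffOn ℝ (⊤ : ℕ∞) (Function.uncurry T) (S ×ˢ ({x₀}ᶜ : Set (EuclideanSpace ℝ (Fin 3)))) ∧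
      (∀ t ∈ S, ∀ x, Literature.Analysis.FluidPDE.curl (u t) x =
        Literature.Analysis.FluidPDE.cross (gradient (T t) x) (x - x₀)) ∧
      ∀ t ∈ S, ∀ x, x ≠ x₀ →
        Literature.Analysis.FluidPDE.cross
            (gradient (fun z => deriv (fun s => T s z) t + inner ℝ (u t z) (gradient (T t) z)
              - Laplacian.laplacian (T t) z) x) (x - x₀) =
          Literature.Analysis.FluidPDE.cross (gradient (fun z => inner ℝ (u t z) (z - x₀)) x) (gradient (T t) x) := by
  intro S u x₀ hS hV hunthr
  obtain ⟨T, hT, hrep⟩ := PoloidalLiouville.exists_windowToroidalPotential hS hV.smooth_velocity hunthr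
  exact ⟨T, hT, hrep, PoloidalLiouville.potentialEvolution_of_isOpen S u x₀ T hS hV hT hrep⟩

/-- Alias under the skeleton's stub name. [folklore] -/
theorem stub_windowPotentialLaw :
    ∀ (S : Set ℝ) (u : ℝ → EuclideanSpace ℝ (Fin 3) → EuclideanSpace ℝ (Fin 3)) (x₀ : EuclideanSpace ℝ (Fin 3)),
    IsOpen S → Literature.Analysis.FluidPDE.IsVorticitySolutionOn S 1 u →
    (∀ t ∈ S, ∀ x, ⟪Literature.Analysis.FluidPDE.curl (u t) x, x - x₀⟫_ℝ = 0) →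
    ∃ T : ℝ → EuclideanSpace ℝ (Fin 3) → ℝ,
      ContDiffOn ℝ (⊤ : ℕ∞) (Function.uncurry T) (S ×ˢ ({x₀}ᶜ : Set (EuclideanSpace ℝ (Fin 3)))) ∧
      (∀ t ∈ S, ∀ x, Literature.Analysis.FluidPDE.curl (u t) x =
        Literature.Analysis.FluidPDE.cross (gradient (T t) x) (x - x₀)) ∧
      ∀ t ∈ S, ∀ x, x ≠ x₀ →
        Literature.Analysis.FluidPDE.cross
            (gradient (fun z => deriv (fun s => T s z) t + inner ℝ (u t z) (gradient (T t) z)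
              - Laplacian.laplacian (T t) z) x) (x - x₀) =
          Literature.Analysis.FluidPDE.cross (gradient (fun z => inner ℝ (u t z) (z - x₀)) x) (gradient (T t) x) :=
  windowPotentialLaw

end Summit.NavierStokesRegularity.NavierStokesRegularity.Theorems.UnthreadedRigidity

end
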